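import Summits.ValiantsHypothesis.ValiantsHypothesis.Theorems.KPlusLogSqLawTridiagonalRealStaticPumpPath

/-!
# Route «KPlusLogSqLaw», crux `WeakLifting` (stmt-ValiantsHypothesis-19561) — REAL side of the tridiagonal sector:
# ITERATING THE PUMP — after `k` hierarchical edges the top continuants of an explicit-by-induction static definite tridiagonal
# `(k+4) × (k+4)` monomial matrix satisfy the 17-clause pump invariant with `|R| + |T| = 2k + 1`

HONEST FRAMING.  Helper (`--supports stmt-ValiantsHypothesis-19561 --as helper`), seat val-sym-lift-p1 (g12), cell `pub-symmetroid`,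
2026-08-27.  Assembly of `…PumpStep` (abstract step) and `…PumpPath` (recurrence + base): the two REALISED moves
(`pump_move_I`: edge `b·X^f` with `f` large under a vertex `X⁰`, from `exists_move_signs_sq`; `pump_move_II`: edge `b·X⁰` under a vertex `X^e`
with `e` large, from g11's `exists_move_signs` read in `u = −z`) and the induction `pump_iter`: for every `k` there are vertex exponents
`e`, link data `(b, f)` — the base `(0,0,1,0; 1·X, ½, 2·X²)` extended by one hierarchical edge per step, of type I / II alternately — a
reflection sign `ρ = ±1` and sample data such that `z ↦ D_{k+3}(ρz)`, `z ↦ D_{k+4}(ρz)` satisfy the pump invariant with `|R| + |T| = 2k + 1`,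
i.e. the newest continuant `D_{k+4}` has `|T| + 2` certified sign alternations near one end while `D_{k+3}` keeps `|R| + 2` at the other —
the anti-aligned clusters that the HARVEST (companion file) converts into `2(k+5) − 7` resp. `2(k+5) − 6` positive zeros of `D_{k+5}`.
Exponents exist by the Archimedean property only (astronomical).  Nothing here is an upper bound; nothing bears on `WeakLifting` /
`TropicalB` in their windows, Conjecture B, the doors, `MatrixDescartes` (stmt-18050) or VP ≠ VNP.  [mechanism: val-sym-lift-p3 g9's pump; folklore]
-/

-- `Summit.ValiantsHypothesis.ValiantsHypothesis.…` repeats a component by the D-0017 layout (single-conjunct summit); the name is mandated.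
set_option linter.dupNamespace false
set_option autoImplicit false

namespace Summit.ValiantsHypothesis.ValiantsHypothesis.Theorems.KPlusLogSqLaw.StaticTridiagonalRealLadder

open Polynomial
open Summit.ValiantsHypothesis.ValiantsHypothesis.Theorems.ValuativeFlip (ctK ctPath ctPath_apply ctK_zero ctK_one ctK_add_two)
open Summit.ValiantsHypothesis.ValiantsHypothesis.Theorems.KPlusLogSqLaw.StaticTridiagonalRealExcess (exists_move_signs)

/-! ### Small list facts -/

/-- along an alternation list with at least two entries the function vanishes nowhere. [folklore] -/
theorem ne_zero_of_isChain_alt₂ {φ : ℝ → ℝ} {a : ℝ} {l : List ℝ} (h : (a :: l).IsChain (fun u v => φ u * φ v < 0))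
    (hl : l ≠ []) : ∀ u ∈ a :: l, φ u ≠ 0 := by
  obtain ⟨b, l', rfl⟩ := List.exists_cons_of_ne_nil hl
  exact ne_zero_of_isChain_alt h

/-- the head of a strictly increasing list is below every entry. [folklore] -/
theorem head_le_of_isChain {a : ℝ} {l : List ℝ} (h : (a :: l).IsChain (· < ·)) : ∀ u ∈ a :: l, a ≤ u := by
  intro u hu
  rcases List.mem_cons.mp hu with rfl | hu
  · exact le_rfl
  · exact le_of_lt ((List.pairwise_cons.mp (List.isChain_iff_pairwise.mp h)).1 u hu)

/-- every entry of the strictly increasing sample list is at most the last point `P1`. [folklore] -/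
theorem le_last_of_isChain {P0 x x₁ M y y₁ P1 : ℝ} {R T : List ℝ} (h : (P0 :: x :: x₁ :: (R ++ M :: (T ++ [y, y₁, P1]))).IsChain (· < ·)) :
    ∀ u ∈ (P0 :: x :: x₁ :: (R ++ M :: (T ++ [y, y₁, P1]))), u ≤ P1 := by
  have e : (P0 :: x :: x₁ :: (R ++ M :: (T ++ [y, y₁, P1]))) = (P0 :: x :: x₁ :: (R ++ M :: (T ++ [y, y₁]))) ++ [P1] := by simp
  rw [e] at h ⊢
  intro u hu
  rcases List.mem_append.mp hu with hu | hu
  · exact le_of_lt ((List.pairwise_append.mp (List.isChain_iff_pairwise.mp h)).2.2 u hu P1 (by simp))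
  · simp only [List.mem_singleton] at hu; exact hu.le

/-! ### The two realised moves -/

/-- **Move of type I** (edge `√κ·X^f` under a vertex `X⁰`, switching between `x` and `x₁`): `h = g − κ z^{2f} f` has the sign of `g` at
`P0, x` and of `−f` at the other sample points. [g11's move lemma, even exponent] -/
theorem pump_move_I {F G : ℝ → ℝ} {P0 x x₁ M y y₁ P1 : ℝ} {R T : List ℝ} (hP0 : 0 < P0) (c1 : (P0 :: x :: x₁ :: (R ++ M :: (T ++ [y, y₁, P1]))).IsChain (· < ·))
    (hG0 : G P0 ≠ 0) (hGx : G x ≠ 0) (hF : ∀ P ∈ (x₁ :: (R ++ M :: (T ++ [y, y₁, P1]))), F P ≠ 0) :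
    ∃ (fe : ℕ) (κ : ℝ), 0 < κ ∧ 0 < (G P0 - κ * P0 ^ (2 * fe) * F P0) * G P0 ∧ 0 < (G x - κ * x ^ (2 * fe) * F x) * G x ∧
      ∀ P ∈ (x₁ :: (R ++ M :: (T ++ [y, y₁, P1]))), 0 < -((G P - κ * P ^ (2 * fe) * F P) * F P) := by
  have o1 : P0 < x := (List.isChain_cons_cons.mp c1).1
  have c1' := (List.isChain_cons_cons.mp c1).2
  have o2 : x < x₁ := (List.isChain_cons_cons.mp c1').1
  have ctail : (x₁ :: (R ++ M :: (T ++ [y, y₁, P1]))).IsChain (· < ·) := (List.isChain_cons_cons.mp c1').2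
  obtain ⟨fe, κ, hκ, hl, hr⟩ := exists_move_signs_sq G F ({P0, x} : Finset ℝ) (x₁ :: (R ++ M :: (T ++ [y, y₁, P1]))).toFinset (hP0.trans o1) o2
    (by
      intro u hu
      rw [Finset.mem_insert, Finset.mem_singleton] at hu
      rcases hu with rfl | rfl
      · exact ⟨hP0, o1.le, hG0⟩
      · exact ⟨hP0.trans o1, le_rfl, hGx⟩)
    (by
      intro u hu
      rw [List.mem_toFinset] at hu
      exact ⟨head_le_of_isChain ctail u hu, hF u hu⟩)
  exact ⟨fe, κ, hκ, hl P0 (by simp), hl x (by simp), fun P hP => hr P (List.mem_toFinset.mpr hP)⟩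

/-- **Move of type II** (edge `√κ·X⁰` under a vertex `X^L`, `L` large), for a state written in REFLECTED coordinates (all sample points
negative, actual points `u = −z`): `h z = (−z)^L g z − κ f z` has the sign of `g` at `P0, x` and of `−f` at the other sample points.
[g11's move lemma read in `u = −z`] -/
theorem pump_move_II {F G : ℝ → ℝ} {P0 x x₁ M y y₁ P1 : ℝ} {R T : List ℝ} (hP1 : P1 < 0) (c1 : (P0 :: x :: x₁ :: (R ++ M :: (T ++ [y, y₁, P1]))).IsChain (· < ·))
    (hG0 : G P0 ≠ 0) (hGx : G x ≠ 0) (hF : ∀ P ∈ (x₁ :: (R ++ M :: (T ++ [y, y₁, P1]))), F P ≠ 0) :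
    ∃ (L : ℕ) (κ : ℝ), 0 < κ ∧ 0 < ((-P0) ^ L * G P0 - κ * F P0) * G P0 ∧ 0 < ((-x) ^ L * G x - κ * F x) * G x ∧
      ∀ P ∈ (x₁ :: (R ++ M :: (T ++ [y, y₁, P1]))), 0 < -(((-P) ^ L * G P - κ * F P) * F P) := by
  have o1 : P0 < x := (List.isChain_cons_cons.mp c1).1
  have c1' := (List.isChain_cons_cons.mp c1).2
  have o2 : x < x₁ := (List.isChain_cons_cons.mp c1').1
  have ctail : (x₁ :: (R ++ M :: (T ++ [y, y₁, P1]))).IsChain (· < ·) := (List.isChain_cons_cons.mp c1').2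
  have hle : ∀ u ∈ (x₁ :: (R ++ M :: (T ++ [y, y₁, P1]))), u ≤ P1 := fun u hu => le_last_of_isChain c1 u (by simp only [List.mem_cons] at hu ⊢; tauto)
  have hx₁neg : x₁ < 0 := lt_of_le_of_lt (hle x₁ (by simp)) hP1
  obtain ⟨L, κ', hκ', hl, hr⟩ := exists_move_signs (fun u => F (-u)) (fun u => G (-u)) ((x₁ :: (R ++ M :: (T ++ [y, y₁, P1]))).toFinset.image (fun z : ℝ => -z))
    ({-x, -P0} : Finset ℝ) (r₁ := -x₁) (r₂ := -x) (by linarith) (by linarith)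
    (by
      intro u hu
      rw [Finset.mem_image] at hu
      obtain ⟨P, hP, rfl⟩ := hu
      rw [List.mem_toFinset] at hP
      refine ⟨by linarith [hle P hP], by linarith [head_le_of_isChain ctail P hP], ?_⟩
      show F (- -P) ≠ 0
      rw [neg_neg]; exact hF P hP)
    (by
      intro u hu
      rw [Finset.mem_insert, Finset.mem_singleton] at hu
      rcases hu with rfl | rfl
      · exact ⟨le_rfl, by show G (- -x) ≠ 0; rw [neg_neg]; exact hGx⟩
      · exact ⟨by linarith, by show G (- -P0) ≠ 0; rw [neg_neg]; exact hG0⟩)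
  refine ⟨L, 1 / κ', by positivity, ?_, ?_, ?_⟩
  · have := hr (-P0) (by simp)
    simp only [neg_neg] at this
    have e : ((-P0) ^ L * G P0 - 1 / κ' * F P0) * G P0 = (1 / κ') * -((F P0 - κ' * (-P0) ^ L * G P0) * G P0) := by
      field_simp; ring
    rw [e]; positivity
  · have := hr (-x) (by simp)
    simp only [neg_neg] at this
    have e : ((-x) ^ L * G x - 1 / κ' * F x) * G x = (1 / κ') * -((F x - κ' * (-x) ^ L * G x) * G x) := by
      field_simp; ring
    rw [e]; positivity
  · intro P hP
    have := hl (-P) (Finset.mem_image.mpr ⟨P, List.mem_toFinset.mpr hP, rfl⟩)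
    simp only [neg_neg] at this
    have e : -(((-P) ^ L * G P - 1 / κ' * F P) * F P) = (1 / κ') * ((F P - κ' * (-P) ^ L * G P) * F P) := by
      field_simp; ring
    rw [e]; positivity

/-! ### The iteration -/

/-- the base state of `…PumpPath.pump_base`, with the sizes spelled `0 + 3`, `0 + 4` as the induction produces them. [data of this seat] -/
theorem pump_base₀ :
    ((-(6 / 5 : ℝ)) :: (-(19 / 20 : ℝ)) :: (-(9 / 10 : ℝ)) :: (([] : List ℝ) ++ (-(3 / 5 : ℝ)) :: (([-(9 / 25 : ℝ)] : List ℝ) ++ [(-(29 / 100 : ℝ)), (-(7 / 25 : ℝ)), (-(1 / 5 : ℝ))]))).IsChain (· < ·) ∧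
      0 < (1 : ℝ) * (fun z : ℝ => (((ctPath (fun t => (X : ℝ[X]) ^ (fun t : ℕ => if t = 2 then (1 : ℕ) else 0) t) (fun t => C ((fun t : ℕ => if t = 0 then (1 : ℝ) else if t = 1 then 1 / 2 else 2) t) * X ^ (fun t : ℕ => if t = 0 then (1 : ℕ) else if t = 1 then 0 else 2) t) (fun t => C ((fun t : ℕ => if t = 0 then (1 : ℝ) else if t = 1 then 1 / 2 else 2) (t - 1)) * X ^ (fun t : ℕ => if t = 0 then (1 : ℕ) else if t = 1 then 0 else 2) (t - 1)) (0 + 4))).det).eval ((-1 : ℝ) * z)) (-(6 / 5 : ℝ)) ∧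
      (1 : ℝ) * (fun z : ℝ => (((ctPath (fun t => (X : ℝ[X]) ^ (fun t : ℕ => if t = 2 then (1 : ℕ) else 0) t) (fun t => C ((fun t : ℕ => if t = 0 then (1 : ℝ) else if t = 1 then 1 / 2 else 2) t) * X ^ (fun t : ℕ => if t = 0 then (1 : ℕ) else if t = 1 then 0 else 2) t) (fun t => C ((fun t : ℕ => if t = 0 then (1 : ℝ) else if t = 1 then 1 / 2 else 2) (t - 1)) * X ^ (fun t : ℕ => if t = 0 then (1 : ℕ) else if t = 1 then 0 else 2) (t - 1)) (0 + 4))).det).eval ((-1 : ℝ) * z)) (-(19 / 20 : ℝ)) < 0 ∧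
      (1 : ℝ) * (fun z : ℝ => (((ctPath (fun t => (X : ℝ[X]) ^ (fun t : ℕ => if t = 2 then (1 : ℕ) else 0) t) (fun t => C ((fun t : ℕ => if t = 0 then (1 : ℝ) else if t = 1 then 1 / 2 else 2) t) * X ^ (fun t : ℕ => if t = 0 then (1 : ℕ) else if t = 1 then 0 else 2) t) (fun t => C ((fun t : ℕ => if t = 0 then (1 : ℝ) else if t = 1 then 1 / 2 else 2) (t - 1)) * X ^ (fun t : ℕ => if t = 0 then (1 : ℕ) else if t = 1 then 0 else 2) (t - 1)) (0 + 4))).det).eval ((-1 : ℝ) * z)) (-(9 / 10 : ℝ)) < 0 ∧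
      (∀ r ∈ ([] : List ℝ), (1 : ℝ) * (fun z : ℝ => (((ctPath (fun t => (X : ℝ[X]) ^ (fun t : ℕ => if t = 2 then (1 : ℕ) else 0) t) (fun t => C ((fun t : ℕ => if t = 0 then (1 : ℝ) else if t = 1 then 1 / 2 else 2) t) * X ^ (fun t : ℕ => if t = 0 then (1 : ℕ) else if t = 1 then 0 else 2) t) (fun t => C ((fun t : ℕ => if t = 0 then (1 : ℝ) else if t = 1 then 1 / 2 else 2) (t - 1)) * X ^ (fun t : ℕ => if t = 0 then (1 : ℕ) else if t = 1 then 0 else 2) (t - 1)) (0 + 4))).det).eval ((-1 : ℝ) * z)) r < 0) ∧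
      (1 : ℝ) * (fun z : ℝ => (((ctPath (fun t => (X : ℝ[X]) ^ (fun t : ℕ => if t = 2 then (1 : ℕ) else 0) t) (fun t => C ((fun t : ℕ => if t = 0 then (1 : ℝ) else if t = 1 then 1 / 2 else 2) t) * X ^ (fun t : ℕ => if t = 0 then (1 : ℕ) else if t = 1 then 0 else 2) t) (fun t => C ((fun t : ℕ => if t = 0 then (1 : ℝ) else if t = 1 then 1 / 2 else 2) (t - 1)) * X ^ (fun t : ℕ => if t = 0 then (1 : ℕ) else if t = 1 then 0 else 2) (t - 1)) (0 + 4))).det).eval ((-1 : ℝ) * z)) (-(3 / 5 : ℝ)) < 0 ∧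
      ((-(3 / 5 : ℝ)) :: (([-(9 / 25 : ℝ)] : List ℝ) ++ [(-(29 / 100 : ℝ))])).IsChain (fun u v => (fun z : ℝ => (((ctPath (fun t => (X : ℝ[X]) ^ (fun t : ℕ => if t = 2 then (1 : ℕ) else 0) t) (fun t => C ((fun t : ℕ => if t = 0 then (1 : ℝ) else if t = 1 then 1 / 2 else 2) t) * X ^ (fun t : ℕ => if t = 0 then (1 : ℕ) else if t = 1 then 0 else 2) t) (fun t => C ((fun t : ℕ => if t = 0 then (1 : ℝ) else if t = 1 then 1 / 2 else 2) (t - 1)) * X ^ (fun t : ℕ => if t = 0 then (1 : ℕ) else if t = 1 then 0 else 2) (t - 1)) (0 + 4))).det).eval ((-1 : ℝ) * z)) u * (fun z : ℝ => (((ctPath (fun t => (X : ℝ[X]) ^ (fun t : ℕ => if t = 2 then (1 : ℕ) else 0) t) (fun t => C ((fun t : ℕ => if t = 0 then (1 : ℝ) else if t = 1 then 1 / 2 else 2) t) * X ^ (fun t : ℕ => if t = 0 then (1 : ℕ) else if t = 1 then 0 else 2) t) (fun t => C ((fun t : ℕ => if t = 0 then (1 : ℝ) else if t = 1 then 1 /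 2 else 2) (t - 1)) * X ^ (fun t : ℕ => if t = 0 then (1 : ℕ) else if t = 1 then 0 else 2) (t - 1)) (0 + 4))).det).eval ((-1 : ℝ) * z)) v < 0) ∧
      (1 : ℝ) * (fun z : ℝ => (((ctPath (fun t => (X : ℝ[X]) ^ (fun t : ℕ => if t = 2 then (1 : ℕ) else 0) t) (fun t => C ((fun t : ℕ => if t = 0 then (1 : ℝ) else if t = 1 then 1 / 2 else 2) t) * X ^ (fun t : ℕ => if t = 0 then (1 : ℕ) else if t = 1 then 0 else 2) t) (fun t => C ((fun t : ℕ => if t = 0 then (1 : ℝ) else if t = 1 then 1 / 2 else 2) (t - 1)) * X ^ (fun t : ℕ => if t = 0 then (1 : ℕ) else if t = 1 then 0 else 2) (t - 1)) (0 + 4))).det).eval ((-1 : ℝ) * z)) (-(29 / 100 : ℝ)) < 0 ∧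
      (1 : ℝ) * (fun z : ℝ => (((ctPath (fun t => (X : ℝ[X]) ^ (fun t : ℕ => if t = 2 then (1 : ℕ) else 0) t) (fun t => C ((fun t : ℕ => if t = 0 then (1 : ℝ) else if t = 1 then 1 / 2 else 2) t) * X ^ (fun t : ℕ => if t = 0 then (1 : ℕ) else if t = 1 then 0 else 2) t) (fun t => C ((fun t : ℕ => if t = 0 then (1 : ℝ) else if t = 1 then 1 / 2 else 2) (t - 1)) * X ^ (fun t : ℕ => if t = 0 then (1 : ℕ) else if t = 1 then 0 else 2) (t - 1)) (0 + 3))).det).eval ((-1 : ℝ) * z)) (-(9 / 10 : ℝ)) < 0 ∧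
      ((-(9 / 10 : ℝ)) :: (([] : List ℝ) ++ [(-(3 / 5 : ℝ))])).IsChain (fun u v => (fun z : ℝ => (((ctPath (fun t => (X : ℝ[X]) ^ (fun t : ℕ => if t = 2 then (1 : ℕ) else 0) t) (fun t => C ((fun t : ℕ => if t = 0 then (1 : ℝ) else if t = 1 then 1 / 2 else 2) t) * X ^ (fun t : ℕ => if t = 0 then (1 : ℕ) else if t = 1 then 0 else 2) t) (fun t => C ((fun t : ℕ => if t = 0 then (1 : ℝ) else if t = 1 then 1 / 2 else 2) (t - 1)) * X ^ (fun t : ℕ => if t = 0 then (1 : ℕ) else if t = 1 then 0 else 2) (t - 1)) (0 + 3))).det).eval ((-1 : ℝ) * z)) u * (fun z : ℝ => (((ctPath (fun t => (X : ℝ[X]) ^ (fun t : ℕ => if t = 2 then (1 : ℕ) else 0) t) (fun t => C ((fun t : ℕ => if t = 0 then (1 : ℝ) else if t = 1 then 1 / 2 else 2) t) * X ^ (fun t : ℕ => if t = 0 then (1 : ℕ) else if t = 1 then 0 else 2) t) (fun t => C ((fun t : ℕ => if t = 0 then (1 : ℝ) else if t = 1 then 1 / 2 else 2) (t - 1)) *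 X ^ (fun t : ℕ => if t = 0 then (1 : ℕ) else if t = 1 then 0 else 2) (t - 1)) (0 + 3))).det).eval ((-1 : ℝ) * z)) v < 0) ∧
      0 < (1 : ℝ) * (fun z : ℝ => (((ctPath (fun t => (X : ℝ[X]) ^ (fun t : ℕ => if t = 2 then (1 : ℕ) else 0) t) (fun t => C ((fun t : ℕ => if t = 0 then (1 : ℝ) else if t = 1 then 1 / 2 else 2) t) * X ^ (fun t : ℕ => if t = 0 then (1 : ℕ) else if t = 1 then 0 else 2) t) (fun t => C ((fun t : ℕ => if t = 0 then (1 : ℝ) else if t = 1 then 1 / 2 else 2) (t - 1)) * X ^ (fun t : ℕ => if t = 0 then (1 : ℕ) else if t = 1 then 0 else 2) (t - 1)) (0 + 3))).det).eval ((-1 : ℝ) * z)) (-(3 / 5 : ℝ)) ∧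
      (∀ t ∈ ([-(9 / 25 : ℝ)] : List ℝ), 0 < (1 : ℝ) * (fun z : ℝ => (((ctPath (fun t => (X : ℝ[X]) ^ (fun t : ℕ => if t = 2 then (1 : ℕ) else 0) t) (fun t => C ((fun t : ℕ => if t = 0 then (1 : ℝ) else if t = 1 then 1 / 2 else 2) t) * X ^ (fun t : ℕ => if t = 0 then (1 : ℕ) else if t = 1 then 0 else 2) t) (fun t => C ((fun t : ℕ => if t = 0 then (1 : ℝ) else if t = 1 then 1 / 2 else 2) (t - 1)) * X ^ (fun t : ℕ => if t = 0 then (1 : ℕ) else if t = 1 then 0 else 2) (t - 1)) (0 + 3))).det).eval ((-1 : ℝ) * z)) t) ∧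
      0 < (1 : ℝ) * (fun z : ℝ => (((ctPath (fun t => (X : ℝ[X]) ^ (fun t : ℕ => if t = 2 then (1 : ℕ) else 0) t) (fun t => C ((fun t : ℕ => if t = 0 then (1 : ℝ) else if t = 1 then 1 / 2 else 2) t) * X ^ (fun t : ℕ => if t = 0 then (1 : ℕ) else if t = 1 then 0 else 2) t) (fun t => C ((fun t : ℕ => if t = 0 then (1 : ℝ) else if t = 1 then 1 / 2 else 2) (t - 1)) * X ^ (fun t : ℕ => if t = 0 then (1 : ℕ) else if t = 1 then 0 else 2) (t - 1)) (0 + 3))).det).eval ((-1 : ℝ) * z)) (-(29 / 100 : ℝ)) ∧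
      0 < (1 : ℝ) * (fun z : ℝ => (((ctPath (fun t => (X : ℝ[X]) ^ (fun t : ℕ => if t = 2 then (1 : ℕ) else 0) t) (fun t => C ((fun t : ℕ => if t = 0 then (1 : ℝ) else if t = 1 then 1 / 2 else 2) t) * X ^ (fun t : ℕ => if t = 0 then (1 : ℕ) else if t = 1 then 0 else 2) t) (fun t => C ((fun t : ℕ => if t = 0 then (1 : ℝ) else if t = 1 then 1 / 2 else 2) (t - 1)) * X ^ (fun t : ℕ => if t = 0 then (1 : ℕ) else if t = 1 then 0 else 2) (t - 1)) (0 + 3))).det).eval ((-1 : ℝ) * z)) (-(7 / 25 : ℝ)) ∧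
      (1 : ℝ) * (fun z : ℝ => (((ctPath (fun t => (X : ℝ[X]) ^ (fun t : ℕ => if t = 2 then (1 : ℕ) else 0) t) (fun t => C ((fun t : ℕ => if t = 0 then (1 : ℝ) else if t = 1 then 1 / 2 else 2) t) * X ^ (fun t : ℕ => if t = 0 then (1 : ℕ) else if t = 1 then 0 else 2) t) (fun t => C ((fun t : ℕ => if t = 0 then (1 : ℝ) else if t = 1 then 1 / 2 else 2) (t - 1)) * X ^ (fun t : ℕ => if t = 0 then (1 : ℕ) else if t = 1 then 0 else 2) (t - 1)) (0 + 3))).det).eval ((-1 : ℝ) * z)) (-(1 / 5 : ℝ)) < 0 ∧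
      (∀ z ∈ Set.Icc (-(6 / 5 : ℝ)) (-(9 / 10 : ℝ)), (1 : ℝ) * (fun z : ℝ => (((ctPath (fun t => (X : ℝ[X]) ^ (fun t : ℕ => if t = 2 then (1 : ℕ) else 0) t) (fun t => C ((fun t : ℕ => if t = 0 then (1 : ℝ) else if t = 1 then 1 / 2 else 2) t) * X ^ (fun t : ℕ => if t = 0 then (1 : ℕ) else if t = 1 then 0 else 2) t) (fun t => C ((fun t : ℕ => if t = 0 then (1 : ℝ) else if t = 1 then 1 / 2 else 2) (t - 1)) * X ^ (fun t : ℕ => if t = 0 then (1 : ℕ) else if t = 1 then 0 else 2) (t - 1)) (0 + 3))).det).eval ((-1 : ℝ) * z)) z < 0) ∧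
      (∀ z ∈ Set.Icc (-(29 / 100 : ℝ)) (-(1 / 5 : ℝ)), (1 : ℝ) * (fun z : ℝ => (((ctPath (fun t => (X : ℝ[X]) ^ (fun t : ℕ => if t = 2 then (1 : ℕ) else 0) t) (fun t => C ((fun t : ℕ => if t = 0 then (1 : ℝ) else if t = 1 then 1 / 2 else 2) t) * X ^ (fun t : ℕ => if t = 0 then (1 : ℕ) else if t = 1 then 0 else 2) t) (fun t => C ((fun t : ℕ => if t = 0 then (1 : ℝ) else if t = 1 then 1 / 2 else 2) (t - 1)) * X ^ (fun t : ℕ => if t = 0 then (1 : ℕ) else if t = 1 then 0 else 2) (t - 1)) (0 + 4))).det).eval ((-1 : ℝ) * z)) z < 0) := by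
  have e3 : ∀ u : ℝ, (((ctPath (fun t => (X : ℝ[X]) ^ (fun t : ℕ => if t = 2 then (1 : ℕ) else 0) t) (fun t => C ((fun t : ℕ => if t = 0 then (1 : ℝ) else if t = 1 then 1 / 2 else 2) t) * X ^ (fun t : ℕ => if t = 0 then (1 : ℕ) else if t = 1 then 0 else 2) t) (fun t => C ((fun t : ℕ => if t = 0 then (1 : ℝ) else if t = 1 then 1 / 2 else 2) (t - 1)) * X ^ (fun t : ℕ => if t = 0 then (1 : ℕ) else if t = 1 then 0 else 2) (t - 1)) (0 + 3))).det).eval u = u - u ^ 3 - 1 / 4 := fun u => eval_det_pbase_three u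
  have e4 : ∀ u : ℝ, (((ctPath (fun t => (X : ℝ[X]) ^ (fun t : ℕ => if t = 2 then (1 : ℕ) else 0) t) (fun t => C ((fun t : ℕ => if t = 0 then (1 : ℝ) else if t = 1 then 1 / 2 else 2) t) * X ^ (fun t : ℕ => if t = 0 then (1 : ℕ) else if t = 1 then 0 else 2) t) (fun t => C ((fun t : ℕ => if t = 0 then (1 : ℝ) else if t = 1 then 1 / 2 else 2) (t - 1)) * X ^ (fun t : ℕ => if t = 0 then (1 : ℕ) else if t = 1 then 0 else 2) (t - 1)) (0 + 4))).det).eval u = u - u ^ 3 - 1 / 4 - 4 * u ^ 4 + 4 * u ^ 6 :=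
    fun u => eval_det_pbase_four u
  simp only [neg_mul, one_mul, neg_neg, e3, e4, List.nil_append]
  refine ⟨?_, by norm_num, by norm_num, by norm_num, by simp, by norm_num, ?_, by norm_num, by norm_num, ?_, by norm_num, ?_,
    by norm_num, by norm_num, by norm_num, ?_, ?_⟩
  · simp only [List.nil_append, List.isChain_cons_cons, List.cons_append, List.isChain_singleton, and_true]
    norm_num
  · simp only [List.cons_append, List.nil_append, List.isChain_cons_cons, List.isChain_singleton, and_true]
    norm_num
  · simp only [List.isChain_cons_cons, List.isChain_singleton, and_true]
    norm_num
  · intro t ht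
    simp only [List.mem_singleton] at ht
    rw [ht]; norm_num
  · intro z hz
    have := pbase_three_neg (u := -z) ⟨by linarith [hz.2], by linarith [hz.1]⟩
    linarith
  · intro z hz
    have := pbase_four_neg (u := -z) ⟨by linarith [hz.2], by linarith [hz.1]⟩
    linarith

/-- **AFTER `k` PUMP MOVES** (module docstring): explicit-by-induction data `e, b, f` of a static definite tridiagonal `(k+4) × (k+4)`
monomial matrix, a reflection sign `ρ`, and sample data for which `(z ↦ D_{k+3}(ρz), z ↦ D_{k+4}(ρz))` satisfy the 17-clause pump invariant
with `μ = −ρs`, positive actual sample points, and `|R| + |T| = 2k + 1`. [mechanism: val-sym-lift-p3 g9's pump; folklore analysis] -/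
theorem pump_iter (k : ℕ) :
    ∃ (e : ℕ → ℕ) (b : ℕ → ℝ) (f : ℕ → ℕ) (ρ s μ P0 x x₁ : ℝ) (R : List ℝ) (M : ℝ) (T : List ℝ) (y y₁ P1 : ℝ),
    (ρ = 1 ∨ ρ = -1) ∧ μ = -(ρ * s) ∧ 0 < ρ * P0 ∧ 0 < ρ * P1 ∧ R.length + T.length = 2 * k + 1 ∧
    ((P0 :: x :: x₁ :: (R ++ M :: (T ++ [y, y₁, P1]))).IsChain (· < ·) ∧
    0 < s * (fun z : ℝ => (((ctPath (fun t => (X : ℝ[X]) ^ e t) (fun t => C (b t) * X ^ f t) (fun t => C (b (t - 1)) * X ^ f (t - 1)) (k + 4))).det).eval (ρ * z)) P0 ∧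
    s * (fun z : ℝ => (((ctPath (fun t => (X : ℝ[X]) ^ e t) (fun t => C (b t) * X ^ f t) (fun t => C (b (t - 1)) * X ^ f (t - 1)) (k + 4))).det).eval (ρ * z)) x < 0 ∧
    s * (fun z : ℝ => (((ctPath (fun t => (X : ℝ[X]) ^ e t) (fun t => C (b t) * X ^ f t) (fun t => C (b (t - 1)) * X ^ f (t - 1)) (k + 4))).det).eval (ρ * z)) x₁ < 0 ∧
    (∀ r ∈ R, s * (fun z : ℝ => (((ctPath (fun t => (X : ℝ[X]) ^ e t) (fun t => C (b t) * X ^ f t) (fun t => C (b (t - 1)) * X ^ f (t - 1)) (k + 4))).det).eval (ρ * z)) r < 0) ∧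
    s * (fun z : ℝ => (((ctPath (fun t => (X : ℝ[X]) ^ e t) (fun t => C (b t) * X ^ f t) (fun t => C (b (t - 1)) * X ^ f (t - 1)) (k + 4))).det).eval (ρ * z)) M < 0 ∧
    (M :: (T ++ [y])).IsChain (fun u v => (fun z : ℝ => (((ctPath (fun t => (X : ℝ[X]) ^ e t) (fun t => C (b t) * X ^ f t) (fun t => C (b (t - 1)) * X ^ f (t - 1)) (k + 4))).det).eval (ρ * z)) u * (fun z : ℝ => (((ctPath (fun t => (X : ℝ[X]) ^ e t) (fun t => C (b t) * X ^ f t) (fun t => C (b (t - 1)) * X ^ f (t - 1)) (k + 4))).det).eval (ρ * z)) v < 0) ∧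
    μ * (fun z : ℝ => (((ctPath (fun t => (X : ℝ[X]) ^ e t) (fun t => C (b t) * X ^ f t) (fun t => C (b (t - 1)) * X ^ f (t - 1)) (k + 4))).det).eval (ρ * z)) y < 0 ∧
    s * (fun z : ℝ => (((ctPath (fun t => (X : ℝ[X]) ^ e t) (fun t => C (b t) * X ^ f t) (fun t => C (b (t - 1)) * X ^ f (t - 1)) (k + 3))).det).eval (ρ * z)) x₁ < 0 ∧
    (x₁ :: (R ++ [M])).IsChain (fun u v => (fun z : ℝ => (((ctPath (fun t => (X : ℝ[X]) ^ e t) (fun t => C (b t) * X ^ f t) (fun t => C (b (t - 1)) * X ^ f (t - 1)) (k + 3))).det).eval (ρ * z)) u * (fun z : ℝ => (((ctPath (fun t => (X : ℝ[X]) ^ e t) (fun t => C (b t) * X ^ f t) (fun t => C (b (t - 1)) * X ^ f (t - 1)) (k + 3))).det).eval (ρ * z)) v < 0) ∧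
    0 < μ * (fun z : ℝ => (((ctPath (fun t => (X : ℝ[X]) ^ e t) (fun t => C (b t) * X ^ f t) (fun t => C (b (t - 1)) * X ^ f (t - 1)) (k + 3))).det).eval (ρ * z)) M ∧
    (∀ t ∈ T, 0 < μ * (fun z : ℝ => (((ctPath (fun t => (X : ℝ[X]) ^ e t) (fun t => C (b t) * X ^ f t) (fun t => C (b (t - 1)) * X ^ f (t - 1)) (k + 3))).det).eval (ρ * z)) t) ∧
    0 < μ * (fun z : ℝ => (((ctPath (fun t => (X : ℝ[X]) ^ e t) (fun t => C (b t) * X ^ f t) (fun t => C (b (t - 1)) * X ^ f (t - 1)) (k + 3))).det).eval (ρ * z)) y ∧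
    0 < μ * (fun z : ℝ => (((ctPath (fun t => (X : ℝ[X]) ^ e t) (fun t => C (b t) * X ^ f t) (fun t => C (b (t - 1)) * X ^ f (t - 1)) (k + 3))).det).eval (ρ * z)) y₁ ∧
    μ * (fun z : ℝ => (((ctPath (fun t => (X : ℝ[X]) ^ e t) (fun t => C (b t) * X ^ f t) (fun t => C (b (t - 1)) * X ^ f (t - 1)) (k + 3))).det).eval (ρ * z)) P1 < 0 ∧
    (∀ z ∈ Set.Icc P0 x₁, s * (fun z : ℝ => (((ctPath (fun t => (X : ℝ[X]) ^ e t) (fun t => C (b t) * X ^ f t) (fun t => C (b (t - 1)) * X ^ f (t - 1)) (k + 3))).det).eval (ρ * z)) z < 0) ∧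
    (∀ z ∈ Set.Icc y P1, μ * (fun z : ℝ => (((ctPath (fun t => (X : ℝ[X]) ^ e t) (fun t => C (b t) * X ^ f t) (fun t => C (b (t - 1)) * X ^ f (t - 1)) (k + 4))).det).eval (ρ * z)) z < 0)) := by
  induction k with
  | zero =>
    exact ⟨(fun t : ℕ => if t = 2 then (1 : ℕ) else 0), (fun t : ℕ => if t = 0 then (1 : ℝ) else if t = 1 then 1 / 2 else 2), (fun t : ℕ => if t = 0 then (1 : ℕ) else if t = 1 then 0 else 2), -1, 1, 1, -(6 / 5), -(19 / 20), -(9 / 10), [], -(3 / 5),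
      [-(9 / 25)], -(29 / 100), -(7 / 25), -(1 / 5), Or.inr rfl, by norm_num, by norm_num, by norm_num, by simp, pump_base₀⟩
  | succ k ih =>
    obtain ⟨e, b, f, ρ, s, μ, P0, x, x₁, R, M, T, y, y₁, P1, hρ, hμ, hρP0, hρP1, hlen,
      c1, c2a, c2b, c2c, c2d, c2e, c2f, c2g, c3c, c3d, c3e, c3f, c3g, c3h, c3i, c4, c5⟩ := ih
    -- orderings
    have o1 : P0 < x := (List.isChain_cons_cons.mp c1).1
    have o2 : x < x₁ := (List.isChain_cons_cons.mp (List.isChain_cons_cons.mp c1).2).1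
    have hP0P1 : P0 < P1 := lt_of_lt_of_le o1 (le_last_of_isChain c1 x (by simp))
    -- non-vanishing at the sample points
    have hG0 : (fun z : ℝ => (((ctPath (fun t => (X : ℝ[X]) ^ e t) (fun t => C (b t) * X ^ f t) (fun t => C (b (t - 1)) * X ^ f (t - 1)) (k + 4))).det).eval (ρ * z)) P0 ≠ 0 := by
      intro h0; rw [h0, mul_zero] at c2a; exact lt_irrefl _ c2a
    have hGx : (fun z : ℝ => (((ctPath (fun t => (X : ℝ[X]) ^ e t) (fun t => C (b t) * X ^ f t) (fun t => C (b (t - 1)) * X ^ f (t - 1)) (k + 4))).det).eval (ρ * z)) x ≠ 0 := by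
      intro h0; rw [h0, mul_zero] at c2b; exact lt_irrefl _ c2b
    have hF : ∀ P ∈ (x₁ :: (R ++ M :: (T ++ [y, y₁, P1]))), (fun z : ℝ => (((ctPath (fun t => (X : ℝ[X]) ^ e t) (fun t => C (b t) * X ^ f t) (fun t => C (b (t - 1)) * X ^ f (t - 1)) (k + 3))).det).eval (ρ * z)) P ≠ 0 := by
      intro P hP
      simp only [List.mem_cons, List.mem_append, List.mem_nil_iff, or_false] at hP
      rcases hP with rfl | hP | rfl | hP | rfl | rfl | rfl
      · intro h0; rw [h0, mul_zero] at c3c; exact lt_irrefl _ c3c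
      · exact ne_zero_of_isChain_alt₂ c3d (by simp) P (by simp [hP])
      · intro h0; rw [h0, mul_zero] at c3e; exact lt_irrefl _ c3e
      · intro h0; have := c3f P hP; rw [h0, mul_zero] at this; exact lt_irrefl _ this
      · intro h0; rw [h0, mul_zero] at c3g; exact lt_irrefl _ c3g
      · intro h0; rw [h0, mul_zero] at c3h; exact lt_irrefl _ c3h
      · intro h0; rw [h0, mul_zero] at c3i; exact lt_irrefl _ c3i
    have hFc := continuous_eval_det_epath e b f (k + 3) ρ
    have hGc := continuous_eval_det_epath e b f (k + 4) ρ
    rcases hρ with rfl | rfl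
    · ------------------------------------------------------------------ type I move (ρ = 1)
      have hP0 : 0 < P0 := by linarith
      obtain ⟨fe, κ, hκ, m1, m1', m2⟩ := pump_move_I (F := (fun z : ℝ => (((ctPath (fun t => (X : ℝ[X]) ^ e t) (fun t => C (b t) * X ^ f t) (fun t => C (b (t - 1)) * X ^ f (t - 1)) (k + 3))).det).eval (1 * z))) (G := (fun z : ℝ => (((ctPath (fun t => (X : ℝ[X]) ^ e t) (fun t => C (b t) * X ^ f t) (fun t => C (b (t - 1)) * X ^ f (t - 1)) (k + 4))).det).eval (1 * z)))
        hP0 c1 hG0 hGx hF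
      have hhc : Continuous (fun z : ℝ => (fun z : ℝ => (((ctPath (fun t => (X : ℝ[X]) ^ e t) (fun t => C (b t) * X ^ f t) (fun t => C (b (t - 1)) * X ^ f (t - 1)) (k + 4))).det).eval (1 * z)) z - κ * z ^ (2 * fe) * (fun z : ℝ => (((ctPath (fun t => (X : ℝ[X]) ^ e t) (fun t => C (b t) * X ^ f t) (fun t => C (b (t - 1)) * X ^ f (t - 1)) (k + 3))).det).eval (1 * z)) z) :=
        hGc.sub ((continuous_const.mul (continuous_id.pow _)).mul hFc)
      obtain ⟨w₁, w, H⟩ := pump_step (f := (fun z : ℝ => (((ctPath (fun t => (X : ℝ[X]) ^ e t) (fun t => C (b t) * X ^ f t) (fun t => C (b (t - 1)) * X ^ f (t - 1)) (k + 3))).det).eval (1 * z))) (g := (fun z : ℝ => (((ctPath (fun t => (X : ℝ[X]) ^ e t) (fun t => C (b t) * X ^ f t) (fun t => C (b (t - 1)) * X ^ f (t - 1)) (k + 4))).det).eval (1 * z)))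
        (h := fun z : ℝ => (fun z : ℝ => (((ctPath (fun t => (X : ℝ[X]) ^ e t) (fun t => C (b t) * X ^ f t) (fun t => C (b (t - 1)) * X ^ f (t - 1)) (k + 4))).det).eval (1 * z)) z - κ * z ^ (2 * fe) * (fun z : ℝ => (((ctPath (fun t => (X : ℝ[X]) ^ e t) (fun t => C (b t) * X ^ f t) (fun t => C (b (t - 1)) * X ^ f (t - 1)) (k + 3))).det).eval (1 * z)) z)
        hGc hhc c1 c2a c2b c2c c2d c2e c2f c2g c3c c3d c3e c3f c3g c3h c3i c4 c5 m1 m1' m2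
        (by
          intro z hz hz0
          have hzpos : 0 < z := hP0.trans_le hz.1
          refine ⟨1, κ * z ^ (2 * fe), one_pos, by positivity, ?_⟩
          have : (fun z : ℝ => (((ctPath (fun t => (X : ℝ[X]) ^ e t) (fun t => C (b t) * X ^ f t) (fun t => C (b (t - 1)) * X ^ f (t - 1)) (k + 4))).det).eval (1 * z)) z - κ * z ^ (2 * fe) * (fun z : ℝ => (((ctPath (fun t => (X : ℝ[X]) ^ e t) (fun t => C (b t) * X ^ f t) (fun t => C (b (t - 1)) * X ^ f (t - 1)) (k + 3))).det).eval (1 * z)) z = 0 := hz0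
          linarith)
      -- the extended data: vertex exponent 0, link (√κ, fe)
      obtain ⟨e', he'⟩ : ∃ e' : ℕ → ℕ, e' = fun t => if t < k + 4 then e t else 0 := ⟨_, rfl⟩
      obtain ⟨b', hb'⟩ : ∃ b' : ℕ → ℝ, b' = fun t => if t < k + 3 then b t else Real.sqrt κ := ⟨_, rfl⟩
      obtain ⟨f', hf'⟩ : ∃ f' : ℕ → ℕ, f' = fun t => if t < k + 3 then f t else fe := ⟨_, rfl⟩
      have hagree : ∀ n, n ≤ k + 4 → (ctPath (fun t => (X : ℝ[X]) ^ e' t) (fun t => C (b' t) * X ^ f' t) (fun t => C (b' (t - 1)) * X ^ f' (t - 1)) n) = (ctPath (fun t => (X : ℝ[X]) ^ e t) (fun t => C (b t) * X ^ f t) (fun t => C (b (t - 1)) * X ^ f (t - 1)) n) := by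
        intro n hn
        refine ctPath_congr_edata (fun t ht => ?_) (fun t ht => ?_) (fun t ht => ?_)
        · rw [he']; simp only [show t < k + 4 by omega, if_true]
        · rw [hb']; simp only [show t < k + 3 by omega, if_true]
        · rw [hf']; simp only [show t < k + 3 by omega, if_true]
      have hD3 : ∀ u : ℝ, (((ctPath (fun t => (X : ℝ[X]) ^ e' t) (fun t => C (b' t) * X ^ f' t) (fun t => C (b' (t - 1)) * X ^ f' (t - 1)) (k + 3))).det).eval u = (((ctPath (fun t => (X : ℝ[X]) ^ e t) (fun t => C (b t) * X ^ f t) (fun t => C (b (t - 1)) * X ^ f (t - 1)) (k + 3))).det).eval u := by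
        intro u; rw [hagree _ (by omega)]
      have hD4 : ∀ u : ℝ, (((ctPath (fun t => (X : ℝ[X]) ^ e' t) (fun t => C (b' t) * X ^ f' t) (fun t => C (b' (t - 1)) * X ^ f' (t - 1)) (k + 1 + 3))).det).eval u = (((ctPath (fun t => (X : ℝ[X]) ^ e t) (fun t => C (b t) * X ^ f t) (fun t => C (b (t - 1)) * X ^ f (t - 1)) (k + 4))).det).eval u := by
        intro u; rw [hagree _ (by omega)]
      have hD5 : ∀ u : ℝ, (((ctPath (fun t => (X : ℝ[X]) ^ e' t) (fun t => C (b' t) * X ^ f' t) (fun t => C (b' (t - 1)) * X ^ f' (t - 1)) (k + 1 + 4))).det).eval u =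
          (((ctPath (fun t => (X : ℝ[X]) ^ e t) (fun t => C (b t) * X ^ f t) (fun t => C (b (t - 1)) * X ^ f (t - 1)) (k + 4))).det).eval u - κ * u ^ (2 * fe) * (((ctPath (fun t => (X : ℝ[X]) ^ e t) (fun t => C (b t) * X ^ f t) (fun t => C (b (t - 1)) * X ^ f (t - 1)) (k + 3))).det).eval u := by
        intro u
        have h := eval_det_epath_add_two e' b' f' (k + 3) u
        have h1 : e' (k + 3 + 1) = 0 := by rw [he']; simp
        have h2 : b' (k + 3) ^ 2 = κ := by rw [hb']; simp only [lt_irrefl, if_false]; exact Real.sq_sqrt hκ.le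
        have h3 : f' (k + 3) = fe := by rw [hf']; simp
        have h4 : (((ctPath (fun t => (X : ℝ[X]) ^ e' t) (fun t => C (b' t) * X ^ f' t) (fun t => C (b' (t - 1)) * X ^ f' (t - 1)) (k + 3 + 1))).det).eval u = (((ctPath (fun t => (X : ℝ[X]) ^ e t) (fun t => C (b t) * X ^ f t) (fun t => C (b (t - 1)) * X ^ f (t - 1)) (k + 4))).det).eval u := by
          rw [hagree _ (by omega)]
        rw [h1, h2, h3, h4, hD3, pow_zero, one_mul] at h
        exact h
      refine ⟨e', b', f', -1, μ, -s, -P1, -y₁, -y, T.reverse.map (fun z : ℝ => -z), -M,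
        (x :: x₁ :: R).reverse.map (fun z : ℝ => -z), -w, -w₁, -P0, Or.inr rfl, by rw [hμ]; ring, by linarith, by linarith,
        by simp; omega, ?_⟩
      simp only [hD4, hD5, one_mul, neg_mul, neg_neg, mul_neg] at H ⊢
      exact H
    · ------------------------------------------------------------------ type II move (ρ = −1)
      have hP1 : P1 < 0 := by linarith
      obtain ⟨L, κ, hκ, m1, m1', m2⟩ := pump_move_II (F := (fun z : ℝ => (((ctPath (fun t => (X : ℝ[X]) ^ e t) (fun t => C (b t) * X ^ f t) (fun t => C (b (t - 1)) * X ^ f (t - 1)) (k + 3))).det).eval ((-1) * z))) (G := (fun z : ℝ => (((ctPath (fun t => (X : ℝ[X]) ^ e t) (fun t => C (b t) * X ^ f t) (fun t => C (b (t - 1)) * X ^ f (t - 1)) (k + 4))).det).eval ((-1) * z)))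
        hP1 c1 hG0 hGx hF
      have hhc : Continuous (fun z : ℝ => (-z) ^ L * (fun z : ℝ => (((ctPath (fun t => (X : ℝ[X]) ^ e t) (fun t => C (b t) * X ^ f t) (fun t => C (b (t - 1)) * X ^ f (t - 1)) (k + 4))).det).eval ((-1) * z)) z - κ * (fun z : ℝ => (((ctPath (fun t => (X : ℝ[X]) ^ e t) (fun t => C (b t) * X ^ f t) (fun t => C (b (t - 1)) * X ^ f (t - 1)) (k + 3))).det).eval ((-1) * z)) z) :=
        ((continuous_neg.pow L).mul hGc).sub (continuous_const.mul hFc)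
      obtain ⟨w₁, w, H⟩ := pump_step (f := (fun z : ℝ => (((ctPath (fun t => (X : ℝ[X]) ^ e t) (fun t => C (b t) * X ^ f t) (fun t => C (b (t - 1)) * X ^ f (t - 1)) (k + 3))).det).eval ((-1) * z))) (g := (fun z : ℝ => (((ctPath (fun t => (X : ℝ[X]) ^ e t) (fun t => C (b t) * X ^ f t) (fun t => C (b (t - 1)) * X ^ f (t - 1)) (k + 4))).det).eval ((-1) * z)))
        (h := fun z : ℝ => (-z) ^ L * (fun z : ℝ => (((ctPath (fun t => (X : ℝ[X]) ^ e t) (fun t => C (b t) * X ^ f t) (fun t => C (b (t - 1)) * X ^ f (t - 1)) (k + 4))).det).eval ((-1) * z)) z - κ * (fun z : ℝ => (((ctPath (fun t => (X : ℝ[X]) ^ e t) (fun t => C (b t) * X ^ f t) (fun t => C (b (t - 1)) * X ^ f (t - 1)) (k + 3))).det).eval ((-1) * z)) z)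
        hGc hhc c1 c2a c2b c2c c2d c2e c2f c2g c3c c3d c3e c3f c3g c3h c3i c4 c5 m1 m1' m2
        (by
          intro z hz hz0
          have hzneg : 0 < -z := by linarith [hz.2, o2, le_last_of_isChain c1 x₁ (by simp)]
          refine ⟨(-z) ^ L, κ, by positivity, hκ, ?_⟩
          have : (-z) ^ L * (fun z : ℝ => (((ctPath (fun t => (X : ℝ[X]) ^ e t) (fun t => C (b t) * X ^ f t) (fun t => C (b (t - 1)) * X ^ f (t - 1)) (k + 4))).det).eval ((-1) * z)) z - κ * (fun z : ℝ => (((ctPath (fun t => (X : ℝ[X]) ^ e t) (fun t => C (b t) * X ^ f t) (fun t => C (b (t - 1)) * X ^ f (t - 1)) (k + 3))).det).eval ((-1) * z)) z = 0 := hz0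
          linarith)
      -- the extended data: vertex exponent L, link (√κ, 0)
      obtain ⟨e', he'⟩ : ∃ e' : ℕ → ℕ, e' = fun t => if t < k + 4 then e t else L := ⟨_, rfl⟩
      obtain ⟨b', hb'⟩ : ∃ b' : ℕ → ℝ, b' = fun t => if t < k + 3 then b t else Real.sqrt κ := ⟨_, rfl⟩
      obtain ⟨f', hf'⟩ : ∃ f' : ℕ → ℕ, f' = fun t => if t < k + 3 then f t else 0 := ⟨_, rfl⟩
      have hagree : ∀ n, n ≤ k + 4 → (ctPath (fun t => (X : ℝ[X]) ^ e' t) (fun t => C (b' t) * X ^ f' t) (fun t => C (b' (t - 1)) * X ^ f' (t - 1)) n) = (ctPath (fun t => (X : ℝ[X]) ^ e t) (fun t => C (b t) * X ^ f t) (fun t => C (b (t - 1)) * X ^ f (t - 1)) n) := by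
        intro n hn
        refine ctPath_congr_edata (fun t ht => ?_) (fun t ht => ?_) (fun t ht => ?_)
        · rw [he']; simp only [show t < k + 4 by omega, if_true]
        · rw [hb']; simp only [show t < k + 3 by omega, if_true]
        · rw [hf']; simp only [show t < k + 3 by omega, if_true]
      have hD3 : ∀ u : ℝ, (((ctPath (fun t => (X : ℝ[X]) ^ e' t) (fun t => C (b' t) * X ^ f' t) (fun t => C (b' (t - 1)) * X ^ f' (t - 1)) (k + 3))).det).eval u = (((ctPath (fun t => (X : ℝ[X]) ^ e t) (fun t => C (b t) * X ^ f t) (fun t => C (b (t - 1)) * X ^ f (t - 1)) (k + 3))).det).eval u := by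
        intro u; rw [hagree _ (by omega)]
      have hD4 : ∀ u : ℝ, (((ctPath (fun t => (X : ℝ[X]) ^ e' t) (fun t => C (b' t) * X ^ f' t) (fun t => C (b' (t - 1)) * X ^ f' (t - 1)) (k + 1 + 3))).det).eval u = (((ctPath (fun t => (X : ℝ[X]) ^ e t) (fun t => C (b t) * X ^ f t) (fun t => C (b (t - 1)) * X ^ f (t - 1)) (k + 4))).det).eval u := by
        intro u; rw [hagree _ (by omega)]
      have hD5 : ∀ u : ℝ, (((ctPath (fun t => (X : ℝ[X]) ^ e' t) (fun t => C (b' t) * X ^ f' t) (fun t => C (b' (t - 1)) * X ^ f' (t - 1)) (k + 1 + 4))).det).eval u =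
          u ^ L * (((ctPath (fun t => (X : ℝ[X]) ^ e t) (fun t => C (b t) * X ^ f t) (fun t => C (b (t - 1)) * X ^ f (t - 1)) (k + 4))).det).eval u - κ * (((ctPath (fun t => (X : ℝ[X]) ^ e t) (fun t => C (b t) * X ^ f t) (fun t => C (b (t - 1)) * X ^ f (t - 1)) (k + 3))).det).eval u := by
        intro u
        have h := eval_det_epath_add_two e' b' f' (k + 3) u
        have h1 : e' (k + 3 + 1) = L := by rw [he']; simp
        have h2 : b' (k + 3) ^ 2 = κ := by rw [hb']; simp only [lt_irrefl, if_false]; exact Real.sq_sqrt hκ.le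
        have h3 : f' (k + 3) = 0 := by rw [hf']; simp
        have h4 : (((ctPath (fun t => (X : ℝ[X]) ^ e' t) (fun t => C (b' t) * X ^ f' t) (fun t => C (b' (t - 1)) * X ^ f' (t - 1)) (k + 3 + 1))).det).eval u = (((ctPath (fun t => (X : ℝ[X]) ^ e t) (fun t => C (b t) * X ^ f t) (fun t => C (b (t - 1)) * X ^ f (t - 1)) (k + 4))).det).eval u := by
          rw [hagree _ (by omega)]
        rw [h1, h2, h3, h4, hD3, mul_zero, pow_zero, mul_one] at h
        exact h
      refine ⟨e', b', f', 1, μ, -s, -P1, -y₁, -y, T.reverse.map (fun z : ℝ => -z), -M,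
        (x :: x₁ :: R).reverse.map (fun z : ℝ => -z), -w, -w₁, -P0, Or.inl rfl, by rw [hμ]; ring, by linarith, by linarith,
        by simp; omega, ?_⟩
      simp only [hD4, hD5, one_mul, neg_mul, neg_neg, mul_neg] at H ⊢
      exact H

end Summit.ValiantsHypothesis.ValiantsHypothesis.Theorems.KPlusLogSqLaw.StaticTridiagonalRealLadder
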